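/-
Copyright (c) 2026 the pub-hodgecm-mathlib formalisation cell (harness21).  Prover seat hodgecm-mathlib-F0P2-p01 (g15): road «S3-ram» (LEAD F0P3a-plan (g12); architect
A-p16 (g31); owner F0P3a-p06 (g15)), organ A′ (ii): FILE H «CHILD LABELS IN THE TOKENS CURRENCY» («WANT» F0P3a-p01 (g16) 23:50:12Z, junction of the (a2)(B) tree
induction ★ p847302 with the child-label files ★ p847102 ∕ p847187 ∕ p847277 ∕ p847295); 2026-09-01.
-/
import Literature.NumberTheory.Automorphic.UnitaryLatticeTreeFixedChildRankSquareRamified   -- ★ p847295 (this seat): G′; brings ★ G p847277, ★ F p847187, ★ E p847102, ★ D p847085, ★ p847060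
import Literature.NumberTheory.Automorphic.UnitaryLatticeTreeLevelShift                    -- ★ `map_sub_one_latt_le_scaleLattice_iff` (the pattern of §0), ★ `UnitaryLatticeTreeTypes` (`scaleLattice_latt`)
import HarnessLib

/-!
# The lattice graph of a hermitian space — THE LABELS OF A FIXED CHILD IN LATTICE TOKENS (tame-ramified place): depth `LEV`, rank `LEV₂` and class `CLS` of
# `Λ′ = κ·(N₁ + 𝒪w(a,b)) = latt(κ·g(a,b))` read off the parent's line data (Bruhat–Tits 1972 §10; Tits 1979 §3.5; Kottwitz 1986 §3)

Topic `NumberTheory/Automorphic`; namespace `Literature.NumberTheory.Automorphic.UnitaryLatticeTree`.  THEOREMS ONLY (no definition, no instance, no notation, no named fact,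
no `sorry`); kernel lane `--supports stmt-HodgeConjecture-24833`.  Cell `pub/hodgecm-mathlib` (D-0151), crux H413; road «S3-ram» (Literature seeding, count-neutral), organ
A′ (ii) of the P-1-ram skeleton (architect A-p16 (g31)).  THE JUNCTION DICTIONARY asked by the (a2)(B) tree induction (F0P3a-p01 (g16), ★ p847302, TOKENS sheet
d81ac9e9): the induction labels a fixed self-dual LATTICE `Λ` by the `def`-free tokens
`LEV c :≡ Λ.map (toLin'(γ − 1)) ≤ scaleLattice c Λ` («`(γ−1)Λ ⊆ cΛ`», depth), `LEV₂ c :≡ Λ.map (toLin'((γ−1)²)) ≤ scaleLattice c Λ` («`(γ−1)²Λ ⊆ cΛ`», rank `≤ 1` at depth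
`e` iff `LEV₂ (ϖ^{2e+1})`) and `CLS s :≡ ∃ y ∈ Λ, ∃ a′, |a′| = 1 ∧ |(ϖ^e)⁻¹·pairing σ H y ((γ−1)y) − s·a′²| < 1` (square class of the depth-`e` values), while the child-label
files ★ E ∕ F ∕ G ∕ G′ (this seat) speak of the MATRIX `M′ = g⁻¹Mg`, `M = κ⁻¹(γ−1)κ`, `g = g(a,b) = !![a∕ϖ,0,0; 0,1,0; b,0,ϖ]` the frame of the child
`Λ′ = κ·(N₁ + 𝒪w(a,b))` through the line `x̄`, `x = κe₀` (`|a| = 1`, `|b| ≤ 1`).  THIS FILE translates: §0 the generic bridge **`(latt G).map (toLin' A) ≤ scaleLattice c (latt G)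
↔ ∀ i k, |(G⁻¹AG)_{ik}| ≤ |c|`** for ANY matrix `A` and invertible `G` (★ `map_sub_one_latt_le_scaleLattice_iff` is `A = γ − 1`; `LEV₂` needs `A = (γ−1)²`), and
`G⁻¹A²G = (G⁻¹AG)²`; §1 the child frame `G = κ·g(a,b)`: `det` a unit, `G⁻¹(γ−1)G = M′`, `latt G = κ·(N₁ + 𝒪w(a,b))`; §2 DEPTH: `LEV (ϖ^{d−2})` always (`d ≥ 2`),
**`LEV (ϖ^{d−1}) ↔ |M₂₀| ≤ |ϖ|^{d+1}`** (`d ≥ 1`: the line is `Q_Ȳ`-null), and `¬ LEV (ϖ^d)` when the pivot `|M₁₀| = |ϖ|^d` holds (depth EXACTLY `d − 1`); §3 RANK: through a null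
line **`LEV₂ (ϖ^{2d−1}) ↔ |M₁₀| ≠ |ϖ|^d`** (`γ, κ` unitary: the two pivots of ★ G agree), through any line `LEV₂ (ϖ^{2d−3})` (`d ≥ 2`: a drop-2 child has rank `≤ 1`); §4 CLASS:
if the line value `(ϖ^d)⁻¹·B₀(x, (γ−1)x) = (ϖ^d)⁻¹·M₂₀` is residually `s·□` then the child is **`CLS (−s)`** at depth `d − 2` (★ F's token `−B₀(x,(γ−1)x)·u₀²`; the flip by
`χ(−1)`, CERT «child-class flip» B-p14 (g39)).  With F0P2-p06 (g12)'s grandchildren counts (★ p847297) these are the `hR hE hO hP` hypotheses of ★ p847302.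

* §0 `map_toLin'_latt_le_scaleLattice_iff` (generic), `inv_mul_sq_mul_eq_sq`, `v_mul_self_apply_le_of_corner_le` (generic square bound off one large corner).
* §1 `isUnit_det_coe_mul_childFrame`, `inv_coe_mul_childFrame_conj_eq`, `latt_coe_mul_childFrame_eq`.
* §2 **`map_sub_one_childLatt_le_scaleLattice_pred_pred`**, **`map_sub_one_childLatt_le_scaleLattice_pred_iff`**, `forall_v_childFrame_conj_le_pred_iff`, **`not_map_sub_one_childLatt_le_scaleLattice_of_pivot`**.
* §3 **`map_sub_one_sq_childLatt_le_scaleLattice_iff_of_corner`** (null line), **`map_sub_one_sq_childLatt_le_scaleLattice_of_le`** (any line, `ϖ^{2d−3}`).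
* §4 **`exists_mem_childLatt_class_neg_of_lineClass`**.

HONEST LABEL: HC_CM is proved only modulo the 2 remaining named inputs (hLiu418 24832, h413 24833) until rung 0 closes; nothing printed is asserted here (elementary lattice
algebra over a valuation ring); «S3-ram» has no books consequence.

## References
* [BruhatTits1972] F. Bruhat, J. Tits, *Groupes réductifs sur un corps local I*, Publ. Math. IHÉS 41 (1972), §10 (lattice models; vertex stabilisers and their filtrations).
* [Tits1979] J. Tits, *Reductive groups over local fields*, PSPM 33.1 (1979), §3.5 (congruence filtration; reduction mod `𝔭`).
* [Kottwitz1986] R. E. Kottwitz, *Base change for unit elements of Hecke algebras*, Compositio Math. 60 (1986), §3 (levels of fixed lattices; shell recursion).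
* [Serre1980Trees] J.-P. Serre, *Trees* (1980), Ch. II §1.1–1.2 (lattices `latt g`, change of frame, congruence level).
-/

set_option autoImplicit false

noncomputable section

open scoped Valued WithZero Matrix MatrixGroups

namespace Literature.NumberTheory.Automorphic.UnitaryLatticeTree

open Literature.NumberTheory.Automorphic Literature.NumberTheory.Automorphic.HermitianLattice

variable {K : Type*} [Field K] [Valued K ℤᵐ⁰] {σ : K →+* K} {ϖ : K}

/-! ## §0 Generic bridges: a lattice inclusion in a frame is an entrywise bound -/

/-- **`A·latt G ⊆ c·latt G ↔ G⁻¹AG ≡ 0 (mod c)` entrywise**, for ANY matrix `A`, invertible `G` and `c ≠ 0` (★ `map_sub_one_latt_le_scaleLattice_iff` is the case `A = γ − 1`;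
the rank token `LEV₂` needs `A = (γ−1)²`). [cite: Serre1980Trees, II.1.1] [cite: Kottwitz1986, §3] -/
theorem map_toLin'_latt_le_scaleLattice_iff {N : ℕ} {c : K} (hc : c ≠ 0) (A : Matrix (Fin N) (Fin N) K) {G : Matrix (Fin N) (Fin N) K} (hG : IsUnit G.det) :
    (latt G).map ((Matrix.toLin' A).restrictScalars 𝒪[K]) ≤ scaleLattice c (latt G) ↔ ∀ i k, Valued.v ((G⁻¹ * A * G) i k) ≤ Valued.v c := by
  have hcG : IsUnit (c • G).det := by
    rw [Matrix.det_smul]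
    exact (hc.isUnit.pow _).mul hG
  rw [← latt_mul, scaleLattice_latt, latt_le_latt_iff hcG]
  have hinv : (c • G)⁻¹ = c⁻¹ • G⁻¹ :=
    Matrix.inv_eq_left_inv (by rw [Matrix.smul_mul, Matrix.mul_smul, smul_smul, inv_mul_cancel₀ hc, one_smul, Matrix.nonsing_inv_mul _ hG])
  have hmat : (c • G)⁻¹ * (A * G) = c⁻¹ • (G⁻¹ * A * G) := by rw [hinv, Matrix.smul_mul, Matrix.mul_assoc]
  rw [hmat]
  have key : ∀ x : K, Valued.v (c⁻¹ * x) ≤ 1 ↔ Valued.v x ≤ Valued.v c := fun x => by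
    have hc' : Valued.v c ≠ 0 := (Valuation.ne_zero_iff _).2 hc
    rw [map_mul, map_inv₀, ← div_eq_inv_mul, div_le_one₀ (zero_lt_iff.2 hc')]
  constructor
  · intro h i k
    have h1 := h i k
    rw [Matrix.smul_apply, smul_eq_mul] at h1
    exact (key _).1 h1
  · intro h i k
    rw [Matrix.smul_apply, smul_eq_mul]
    exact (key _).2 (h i k)

omit [Valued K ℤᵐ⁰] in
/-- `G⁻¹A²G = (G⁻¹AG)²` for invertible `G`. [cite: Serre1980Trees, II.1.1] -/
theorem inv_mul_sq_mul_eq_sq {N : ℕ} (A : Matrix (Fin N) (Fin N) K) {G : Matrix (Fin N) (Fin N) K} (hG : IsUnit G.det) :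
    G⁻¹ * A ^ 2 * G = (G⁻¹ * A * G) ^ 2 := by
  rw [pow_two, pow_two]
  calc G⁻¹ * (A * A) * G = G⁻¹ * A * (G * G⁻¹) * A * G := by rw [Matrix.mul_nonsing_inv _ hG, Matrix.mul_one]; simp only [Matrix.mul_assoc]
    _ = G⁻¹ * A * G * (G⁻¹ * A * G) := by simp only [Matrix.mul_assoc]

/-- **Square of a matrix with ONE large corner**: if `|P₂₀| ≤ s₂`, every other entry is `≤ s₁` and `s₁ ≤ s₂`, then every entry of `P²` is `≤ s₁·s₂` (no product `P_{ik}P_{kj}` has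
both factors at the corner). [cite: Kottwitz1986, §3] [cite: Tits1979, §3.5] -/
theorem v_mul_self_apply_le_of_corner_le {P : Matrix (Fin 3) (Fin 3) K} {s₁ s₂ : ℤᵐ⁰} (h20 : Valued.v (P 2 0) ≤ s₂)
    (hrest : ∀ k l : Fin 3, ¬ (k = 2 ∧ l = 0) → Valued.v (P k l) ≤ s₁) (hs : s₁ ≤ s₂) (i j : Fin 3) :
    Valued.v ((P * P) i j) ≤ s₁ * s₂ := by
  have hall : ∀ k l, Valued.v (P k l) ≤ s₂ := by
    intro k l
    by_cases h : k = 2 ∧ l = 0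
    · obtain ⟨rfl, rfl⟩ := h; exact h20
    · exact (hrest k l h).trans hs
  have hterm : ∀ k : Fin 3, Valued.v (P i k * P k j) ≤ s₁ * s₂ := by
    intro k
    rw [map_mul]
    by_cases h1 : i = 2 ∧ k = 0
    · obtain ⟨-, rfl⟩ := h1
      have h2 : ¬ ((0 : Fin 3) = 2 ∧ j = 0) := fun h => absurd h.1 (by decide)
      rw [mul_comm]; exact mul_le_mul' (hrest 0 j h2) (hall i 0)
    · exact mul_le_mul' (hrest i k h1) (hall k j)
  rw [Matrix.mul_apply]
  exact Valuation.map_sum_le _ fun k _ => hterm k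

/-! ## §1 The child frame `G = κ·g(a,b)` -/

omit [Valued K ℤᵐ⁰] in
/-- `det(κ·g(a,b))` is a unit (`det g(a,b) = a ≠ 0`, `κ` invertible). [cite: Serre1980Trees, II.1.1] -/
theorem isUnit_det_coe_mul_childFrame (κ : GL (Fin 3) K) (hϖ0 : ϖ ≠ 0) {a : K} (ha0 : a ≠ 0) (b : K) :
    IsUnit (((κ : Matrix (Fin 3) (Fin 3) K) * !![a / ϖ, 0, 0; 0, 1, 0; b, 0, ϖ]).det) := by
  rw [Matrix.det_mul, det_childFrame hϖ0]
  exact (Matrix.isUnits_det_units κ).mul (isUnit_iff_ne_zero.2 ha0)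

omit [Valued K ℤᵐ⁰] in
/-- **Conjugation by the child frame**: `(κg)⁻¹·A·(κg) = g⁻¹·(κ⁻¹Aκ)·g` with the explicit `g⁻¹ = !![ϖ∕a,0,0; 0,1,0; −b∕a,0,ϖ⁻¹]`. [cite: Serre1980Trees, II.1.1] -/
theorem inv_coe_mul_childFrame_conj_eq (κ : GL (Fin 3) K) (hϖ0 : ϖ ≠ 0) {a : K} (ha0 : a ≠ 0) (b : K) (A : Matrix (Fin 3) (Fin 3) K) :
    ((κ : Matrix (Fin 3) (Fin 3) K) * !![a / ϖ, 0, 0; 0, 1, 0; b, 0, ϖ])⁻¹ * A * ((κ : Matrix (Fin 3) (Fin 3) K) * !![a / ϖ, 0, 0; 0, 1, 0; b, 0, ϖ]) =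
      (!![ϖ / a, 0, 0; 0, 1, 0; -b / a, 0, ϖ⁻¹] : Matrix (Fin 3) (Fin 3) K) * ((((κ⁻¹ : GL (Fin 3) K)) : Matrix (Fin 3) (Fin 3) K) * A * (κ : Matrix (Fin 3) (Fin 3) K)) *
        !![a / ϖ, 0, 0; 0, 1, 0; b, 0, ϖ] := by
  have hinv : ((κ : Matrix (Fin 3) (Fin 3) K) * !![a / ϖ, 0, 0; 0, 1, 0; b, 0, ϖ])⁻¹ =
      (!![ϖ / a, 0, 0; 0, 1, 0; -b / a, 0, ϖ⁻¹] : Matrix (Fin 3) (Fin 3) K) * (((κ⁻¹ : GL (Fin 3) K)) : Matrix (Fin 3) (Fin 3) K) := by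
    refine Matrix.inv_eq_left_inv ?_
    rw [Matrix.mul_assoc, ← Matrix.mul_assoc (((κ⁻¹ : GL (Fin 3) K)) : Matrix (Fin 3) (Fin 3) K), ← Units.val_mul, inv_mul_cancel, Units.val_one, Matrix.one_mul,
      inv_childFrame_mul_childFrame hϖ0 ha0]
  rw [hinv]
  simp only [Matrix.mul_assoc]

/-- **The child lattice**: `latt(κ·g(a,b)) = κ·(N₁ + 𝒪w(a,b))` (`|a| = 1`, `|b| ≤ 1`; ★ `latt_childFrame_eq`). [cite: Serre1980Trees, II.1.1] [cite: BruhatTits1972, §10] -/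
theorem latt_coe_mul_childFrame_eq (hϖ : Valued.v ϖ = WithZero.exp (-1 : ℤ)) (κ : GL (Fin 3) K) {a b : K} (ha : Valued.v a = 1) (hb : Valued.v b ≤ 1) :
    latt ((κ : Matrix (Fin 3) (Fin 3) K) * !![a / ϖ, 0, 0; 0, 1, 0; b, 0, ϖ]) =
      mapGL κ (latt (Matrix.diagonal ![(1 : K), 1, ϖ]) ⊔ Submodule.span 𝒪[K] {(![a / ϖ, 0, b] : Fin 3 → K)}) := by
  rw [latt_mul, ← latt_childFrame_eq hϖ ha hb]
  rfl

/-! ## §2 DEPTH of the child in tokens -/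

/-- **`LEV (ϖ^{d−2})` at the child, always** (`d ≥ 2`): `(γ−1)·Λ′ ⊆ ϖ^{d−2}·Λ′` for `Λ′ = latt(κ·g(a,b))`, `M = κ⁻¹(γ−1)κ` of level `ϖ^d`.
[cite: Kottwitz1986, §3] [cite: Tits1979, §3.5] -/
theorem map_sub_one_childLatt_le_scaleLattice_pred_pred (hϖ : Valued.v ϖ = WithZero.exp (-1 : ℤ)) (κ γ : GL (Fin 3) K) {a b : K} (ha : Valued.v a = 1) (hb : Valued.v b ≤ 1)
    {d : ℕ} (hd : 2 ≤ d) (hM : ∀ i j, Valued.v (((((κ⁻¹ : GL (Fin 3) K)) : Matrix (Fin 3) (Fin 3) K) * ((γ : Matrix (Fin 3) (Fin 3) K) - 1) * (κ : Matrix (Fin 3) (Fin 3) K)) i j) ≤ Valued.v ϖ ^ d) :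
    (latt ((κ : Matrix (Fin 3) (Fin 3) K) * !![a / ϖ, 0, 0; 0, 1, 0; b, 0, ϖ])).map ((Matrix.toLin' ((γ : Matrix (Fin 3) (Fin 3) K) - 1)).restrictScalars 𝒪[K]) ≤
      scaleLattice (ϖ ^ (d - 2)) (latt ((κ : Matrix (Fin 3) (Fin 3) K) * !![a / ϖ, 0, 0; 0, 1, 0; b, 0, ϖ])) := by
  have hϖ0 : ϖ ≠ 0 := fun h0 => by rw [h0, map_zero] at hϖ; exact WithZero.coe_ne_zero hϖ.symm
  have ha0 : a ≠ 0 := fun h0 => by rw [h0, map_zero] at ha; exact zero_ne_one ha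
  rw [map_toLin'_latt_le_scaleLattice_iff (pow_ne_zero _ hϖ0) _ (isUnit_det_coe_mul_childFrame κ hϖ0 ha0 b), inv_coe_mul_childFrame_conj_eq κ hϖ0 ha0]
  intro i k
  rw [map_pow]
  exact v_childFrame_conj_le_of_le hϖ ha hb hd hM i k

/-- The matrix form of the next statement: for `d ≥ 1`, ALL entries of `g⁻¹Mg` are `≤ |ϖ|^{d−1}` iff the corner passes `|M₂₀| ≤ |ϖ|^{d+1}` (★ p847102's iff assumed `d ≥ 2`).
[cite: Kottwitz1986, §3] [cite: Tits1979, §3.5] -/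
theorem forall_v_childFrame_conj_le_pred_iff (hϖ : Valued.v ϖ = WithZero.exp (-1 : ℤ)) {a b : K} (ha : Valued.v a = 1) (hb : Valued.v b ≤ 1)
    {d : ℕ} (hd : 1 ≤ d) {M : Matrix (Fin 3) (Fin 3) K} (hM : ∀ i j, Valued.v (M i j) ≤ Valued.v ϖ ^ d) :
    (∀ i j : Fin 3, Valued.v (((!![ϖ / a, 0, 0; 0, 1, 0; -b / a, 0, ϖ⁻¹] : Matrix (Fin 3) (Fin 3) K) * M * !![a / ϖ, 0, 0; 0, 1, 0; b, 0, ϖ]) i j) ≤ Valued.v ϖ ^ (d - 1)) ↔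
      Valued.v (M 2 0) ≤ Valued.v ϖ ^ (d + 1) := by
  have hϖ0 : ϖ ≠ 0 := fun h0 => by rw [h0, map_zero] at hϖ; exact WithZero.coe_ne_zero hϖ.symm
  have hvϖ0 : Valued.v ϖ ≠ 0 := (Valuation.ne_zero_iff _).2 hϖ0
  have hd3 : Valued.v ϖ ^ (d + 1) = Valued.v ϖ ^ 2 * Valued.v ϖ ^ (d - 1) := by rw [← pow_add]; congr 1; omega
  refine ⟨fun h => ?_, fun h20 i j => v_childFrame_conj_le_of_corner hϖ ha hb hd hM h20 i j⟩
  -- `|(a/ϖ²)M₂₀| ≤ max(|M′₂₀|, |M′₂₀ − (a/ϖ²)M₂₀|) ≤ |ϖ|^(d-1)`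
  have hsub := v_childFrame_conj_sub_corner_le hϖ ha hb hd hM 2 0
  rw [Matrix.sub_apply] at hsub
  have hc : Valued.v (a / ϖ ^ 2 * M 2 0) ≤ Valued.v ϖ ^ (d - 1) := by
    have e : a / ϖ ^ 2 * M 2 0 = ((!![ϖ / a, 0, 0; 0, 1, 0; -b / a, 0, ϖ⁻¹] : Matrix (Fin 3) (Fin 3) K) * M * !![a / ϖ, 0, 0; 0, 1, 0; b, 0, ϖ]) 2 0 -
        ((((!![ϖ / a, 0, 0; 0, 1, 0; -b / a, 0, ϖ⁻¹] : Matrix (Fin 3) (Fin 3) K) * M * !![a / ϖ, 0, 0; 0, 1, 0; b, 0, ϖ]) 2 0 -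
          (!![0, 0, 0; 0, 0, 0; a / ϖ ^ 2 * M 2 0, 0, 0] : Matrix (Fin 3) (Fin 3) K) 2 0)) := by simp
    rw [e]
    exact (Valuation.map_sub _ _ _).trans (max_le (h 2 0) hsub)
  rw [map_mul, map_div₀, map_pow, ha, one_div] at hc
  have h' := mul_le_mul' (le_refl (Valued.v ϖ ^ 2)) hc
  rwa [← mul_assoc, mul_inv_cancel₀ (pow_ne_zero _ hvϖ0), one_mul, ← hd3] at h'

/-- **`LEV (ϖ^{d−1})` at the child ↔ the line is `Q_Ȳ`-null** (`d ≥ 1`): `(γ−1)·Λ′ ⊆ ϖ^{d−1}·Λ′ ↔ |M₂₀| ≤ |ϖ|^{d+1}`, `M₂₀ = B₀(x, (γ−1)x)` (★ `inv_mul_mul_apply_two_zero_eq_B₀`).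
[cite: Kottwitz1986, §3] [cite: Tits1979, §3.5] -/
theorem map_sub_one_childLatt_le_scaleLattice_pred_iff (hϖ : Valued.v ϖ = WithZero.exp (-1 : ℤ)) (κ γ : GL (Fin 3) K) {a b : K} (ha : Valued.v a = 1) (hb : Valued.v b ≤ 1)
    {d : ℕ} (hd : 1 ≤ d) (hM : ∀ i j, Valued.v (((((κ⁻¹ : GL (Fin 3) K)) : Matrix (Fin 3) (Fin 3) K) * ((γ : Matrix (Fin 3) (Fin 3) K) - 1) * (κ : Matrix (Fin 3) (Fin 3) K)) i j) ≤ Valued.v ϖ ^ d) :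
    (latt ((κ : Matrix (Fin 3) (Fin 3) K) * !![a / ϖ, 0, 0; 0, 1, 0; b, 0, ϖ])).map ((Matrix.toLin' ((γ : Matrix (Fin 3) (Fin 3) K) - 1)).restrictScalars 𝒪[K]) ≤
        scaleLattice (ϖ ^ (d - 1)) (latt ((κ : Matrix (Fin 3) (Fin 3) K) * !![a / ϖ, 0, 0; 0, 1, 0; b, 0, ϖ])) ↔
      Valued.v (((((κ⁻¹ : GL (Fin 3) K)) : Matrix (Fin 3) (Fin 3) K) * ((γ : Matrix (Fin 3) (Fin 3) K) - 1) * (κ : Matrix (Fin 3) (Fin 3) K)) 2 0) ≤ Valued.v ϖ ^ (d + 1) := by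
  have hϖ0 : ϖ ≠ 0 := fun h0 => by rw [h0, map_zero] at hϖ; exact WithZero.coe_ne_zero hϖ.symm
  have ha0 : a ≠ 0 := fun h0 => by rw [h0, map_zero] at ha; exact zero_ne_one ha
  rw [map_toLin'_latt_le_scaleLattice_iff (pow_ne_zero _ hϖ0) _ (isUnit_det_coe_mul_childFrame κ hϖ0 ha0 b), inv_coe_mul_childFrame_conj_eq κ hϖ0 ha0, map_pow]
  exact forall_v_childFrame_conj_le_pred_iff hϖ ha hb hd hM

/-- **Depth EXACTLY `d − 1` through a null line off the kernel**: if the pivot `|M₁₀| = |ϖ|^d` holds (`x̄ ∉ ker Ȳ`), then `¬ LEV (ϖ^d)` at the child (`d ≥ 1`).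
[cite: Kottwitz1986, §3] [cite: Tits1979, §3.5] -/
theorem not_map_sub_one_childLatt_le_scaleLattice_of_pivot (hϖ : Valued.v ϖ = WithZero.exp (-1 : ℤ)) (κ γ : GL (Fin 3) K) {a b : K} (ha : Valued.v a = 1) (hb : Valued.v b ≤ 1)
    {d : ℕ} (hd : 1 ≤ d) (hM : ∀ i j, Valued.v (((((κ⁻¹ : GL (Fin 3) K)) : Matrix (Fin 3) (Fin 3) K) * ((γ : Matrix (Fin 3) (Fin 3) K) - 1) * (κ : Matrix (Fin 3) (Fin 3) K)) i j) ≤ Valued.v ϖ ^ d)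
    (h10 : Valued.v (((((κ⁻¹ : GL (Fin 3) K)) : Matrix (Fin 3) (Fin 3) K) * ((γ : Matrix (Fin 3) (Fin 3) K) - 1) * (κ : Matrix (Fin 3) (Fin 3) K)) 1 0) = Valued.v ϖ ^ d) :
    ¬ (latt ((κ : Matrix (Fin 3) (Fin 3) K) * !![a / ϖ, 0, 0; 0, 1, 0; b, 0, ϖ])).map ((Matrix.toLin' ((γ : Matrix (Fin 3) (Fin 3) K) - 1)).restrictScalars 𝒪[K]) ≤
        scaleLattice (ϖ ^ d) (latt ((κ : Matrix (Fin 3) (Fin 3) K) * !![a / ϖ, 0, 0; 0, 1, 0; b, 0, ϖ])) := by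
  have hϖ0 : ϖ ≠ 0 := fun h0 => by rw [h0, map_zero] at hϖ; exact WithZero.coe_ne_zero hϖ.symm
  have hvϖ0 : Valued.v ϖ ≠ 0 := (Valuation.ne_zero_iff _).2 hϖ0
  have ha0 : a ≠ 0 := fun h0 => by rw [h0, map_zero] at ha; exact zero_ne_one ha
  have hϖlt : Valued.v ϖ < 1 := by rw [hϖ, ← WithZero.exp_zero]; exact WithZero.exp_lt_exp.2 (by norm_num)
  have hd1 : Valued.v ϖ ^ d = Valued.v ϖ * Valued.v ϖ ^ (d - 1) := by rw [← pow_succ']; congr 1; omega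
  have hlt : Valued.v ϖ ^ d < Valued.v ϖ ^ (d - 1) := by
    rw [hd1]; exact mul_lt_of_lt_one_left (zero_lt_iff.2 (pow_ne_zero _ hvϖ0)) hϖlt
  rw [map_toLin'_latt_le_scaleLattice_iff (pow_ne_zero _ hϖ0) _ (isUnit_det_coe_mul_childFrame κ hϖ0 ha0 b), inv_coe_mul_childFrame_conj_eq κ hϖ0 ha0, map_pow]
  intro h
  have hpiv := (v_childFrame_conj_one_zero_eq_iff hϖ ha hb hd hM).2 h10
  exact (lt_irrefl _) (((h 1 0).trans_lt hlt).trans_eq hpiv.symm)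

/-! ## §3 RANK of the child in tokens -/

/-- **THE RANK TOKEN THROUGH A NULL LINE**: for UNITARY `κ, γ` (`J₀ = antidiag(1,1,1)`, `σ` valuation-preserving), `M = κ⁻¹(γ−1)κ` of level `ϖ^d`, `d ≥ 1`, corner passing
(`|M₂₀| ≤ |ϖ|^{d+1}`): **`(γ−1)²·Λ′ ⊆ ϖ^{2d−1}·Λ′ ↔ |M₁₀| ≠ |ϖ|^d`** — the child (depth `d − 1`) has residual rank `≤ 1` iff the pivot fails, rank `2` iff
`|B₀(κe₁, (γ−1)κe₀)| = |ϖ|^d` (`x̄ ∉ ker Ȳ`); the second pivot `M₂₁` agrees by the skew-hermitian law ★ `v_coe_sub_one_one_zero_eq_iff`.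
[cite: Kottwitz1986, §3] [cite: Tits1979, §3.5] [cite: BruhatTits1972, §10] -/
theorem map_sub_one_sq_childLatt_le_scaleLattice_iff_of_corner (hvσ : ∀ z, Valued.v (σ z) = Valued.v z) (hϖ : Valued.v ϖ = WithZero.exp (-1 : ℤ))
    (κ γ : unitaryGroupOfForm σ ((StdForm.antidiagonal 3).over K)) {a b : K} (ha : Valued.v a = 1) (hb : Valued.v b ≤ 1) {d : ℕ} (hd : 1 ≤ d)
    (hM : ∀ i j, Valued.v (((((κ : GL (Fin 3) K)⁻¹ : GL (Fin 3) K) : Matrix (Fin 3) (Fin 3) K) * (((γ : GL (Fin 3) K) : Matrix (Fin 3) (Fin 3) K) - 1) *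
      ((κ : GL (Fin 3) K) : Matrix (Fin 3) (Fin 3) K)) i j) ≤ Valued.v ϖ ^ d)
    (h20 : Valued.v (((((κ : GL (Fin 3) K)⁻¹ : GL (Fin 3) K) : Matrix (Fin 3) (Fin 3) K) * (((γ : GL (Fin 3) K) : Matrix (Fin 3) (Fin 3) K) - 1) *
      ((κ : GL (Fin 3) K) : Matrix (Fin 3) (Fin 3) K)) 2 0) ≤ Valued.v ϖ ^ (d + 1)) :
    (latt (((κ : GL (Fin 3) K) : Matrix (Fin 3) (Fin 3) K) * !![a / ϖ, 0, 0; 0, 1, 0; b, 0, ϖ])).map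
        ((Matrix.toLin' (((((γ : GL (Fin 3) K)) : Matrix (Fin 3) (Fin 3) K) - 1) ^ 2)).restrictScalars 𝒪[K]) ≤
        scaleLattice (ϖ ^ (2 * d - 1)) (latt (((κ : GL (Fin 3) K) : Matrix (Fin 3) (Fin 3) K) * !![a / ϖ, 0, 0; 0, 1, 0; b, 0, ϖ])) ↔
      Valued.v (((((κ : GL (Fin 3) K)⁻¹ : GL (Fin 3) K) : Matrix (Fin 3) (Fin 3) K) * (((γ : GL (Fin 3) K) : Matrix (Fin 3) (Fin 3) K) - 1) *
        ((κ : GL (Fin 3) K) : Matrix (Fin 3) (Fin 3) K)) 1 0) ≠ Valued.v ϖ ^ d := by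
  have hϖ0 : ϖ ≠ 0 := fun h0 => by rw [h0, map_zero] at hϖ; exact WithZero.coe_ne_zero hϖ.symm
  have ha0 : a ≠ 0 := fun h0 => by rw [h0, map_zero] at ha; exact zero_ne_one ha
  have hG := isUnit_det_coe_mul_childFrame (κ : GL (Fin 3) K) hϖ0 ha0 b
  rw [map_toLin'_latt_le_scaleLattice_iff (pow_ne_zero _ hϖ0) _ hG, inv_mul_sq_mul_eq_sq _ hG, inv_coe_mul_childFrame_conj_eq (κ : GL (Fin 3) K) hϖ0 ha0, map_pow, pow_two,
    forall_v_childFrame_conj_sq_le_iff hϖ ha hb hd hM h20]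
  -- the two pivots agree for the unitary `κ⁻¹γκ`
  have hY : ∀ i j, Valued.v (((((κ⁻¹ * γ * κ : unitaryGroupOfForm σ ((StdForm.antidiagonal 3).over K)) : GL (Fin 3) K) : Matrix (Fin 3) (Fin 3) K) - 1) i j) ≤
      Valued.v ϖ ^ d := by
    intro i j; rw [coe_inv_mul_mul_sub_one]; exact hM i j
  have hagree := v_coe_sub_one_one_zero_eq_iff hvσ hϖ (κ⁻¹ * γ * κ) hd hY
  rw [coe_inv_mul_mul_sub_one] at hagree
  exact ⟨fun h h10 => h ⟨h10, hagree.1 h10⟩, fun h hboth => h hboth.1⟩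

/-- **THE RANK TOKEN OF A DROP-2 CHILD**: for `M = κ⁻¹(γ−1)κ` of level `ϖ^d`, `d ≥ 2` (any line, `κ, γ ∈ GL`): `(γ−1)²·Λ′ ⊆ ϖ^{2d−3}·Λ′` — a child of depth `d − 2` has
residual rank `≤ 1` (its leading matrix is the corner `(aϖ^{−d}M₂₀)·E₂₀`, ★ `v_childFrame_conj_sub_corner_le`, and `E₂₀² = 0`). [cite: Kottwitz1986, §3] [cite: Tits1979, §3.5] -/
theorem map_sub_one_sq_childLatt_le_scaleLattice_of_le (hϖ : Valued.v ϖ = WithZero.exp (-1 : ℤ)) (κ γ : GL (Fin 3) K) {a b : K} (ha : Valued.v a = 1) (hb : Valued.v b ≤ 1)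
    {d : ℕ} (hd : 2 ≤ d) (hM : ∀ i j, Valued.v (((((κ⁻¹ : GL (Fin 3) K)) : Matrix (Fin 3) (Fin 3) K) * ((γ : Matrix (Fin 3) (Fin 3) K) - 1) * (κ : Matrix (Fin 3) (Fin 3) K)) i j) ≤ Valued.v ϖ ^ d) :
    (latt ((κ : Matrix (Fin 3) (Fin 3) K) * !![a / ϖ, 0, 0; 0, 1, 0; b, 0, ϖ])).map ((Matrix.toLin' (((γ : Matrix (Fin 3) (Fin 3) K) - 1) ^ 2)).restrictScalars 𝒪[K]) ≤
      scaleLattice (ϖ ^ (2 * d - 3)) (latt ((κ : Matrix (Fin 3) (Fin 3) K) * !![a / ϖ, 0, 0; 0, 1, 0; b, 0, ϖ])) := by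
  have hϖ0 : ϖ ≠ 0 := fun h0 => by rw [h0, map_zero] at hϖ; exact WithZero.coe_ne_zero hϖ.symm
  have hvϖ0 : Valued.v ϖ ≠ 0 := (Valuation.ne_zero_iff _).2 hϖ0
  have ha0 : a ≠ 0 := fun h0 => by rw [h0, map_zero] at ha; exact zero_ne_one ha
  have hϖ1 : Valued.v ϖ ≤ 1 := by rw [hϖ, ← WithZero.exp_zero]; exact WithZero.exp_le_exp.2 (by norm_num)
  have hG := isUnit_det_coe_mul_childFrame κ hϖ0 ha0 b
  have hsum : Valued.v ϖ ^ (2 * d - 3) = Valued.v ϖ ^ (d - 1) * Valued.v ϖ ^ (d - 2) := by rw [← pow_add]; congr 1; omega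
  rw [map_toLin'_latt_le_scaleLattice_iff (pow_ne_zero _ hϖ0) _ hG, inv_mul_sq_mul_eq_sq _ hG, inv_coe_mul_childFrame_conj_eq κ hϖ0 ha0, map_pow, pow_two, hsum]
  intro i k
  refine v_mul_self_apply_le_of_corner_le (v_childFrame_conj_le_of_le hϖ ha hb hd hM 2 0) (fun k l hkl => ?_) (pow_le_pow_right_of_le_one' hϖ1 (by omega)) i k
  -- off the corner, `M′_{kl} = (M′ − cE₂₀)_{kl}` is `≤ |ϖ|^(d-1)`
  have h := v_childFrame_conj_sub_corner_le hϖ ha hb (by omega : 1 ≤ d) hM k l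
  rw [Matrix.sub_apply] at h
  have hz : (!![0, 0, 0; 0, 0, 0; a / ϖ ^ 2 * ((((κ⁻¹ : GL (Fin 3) K)) : Matrix (Fin 3) (Fin 3) K) * ((γ : Matrix (Fin 3) (Fin 3) K) - 1) * (κ : Matrix (Fin 3) (Fin 3) K)) 2 0, 0, 0] :
      Matrix (Fin 3) (Fin 3) K) k l = 0 := by
    fin_cases k <;> fin_cases l <;> simp_all
  rwa [hz, sub_zero] at h

/-! ## §4 CLASS of the child in tokens -/

/-- **THE CLASS TOKEN OF A DROP-2 CHILD**: for UNITARY `κ, γ` (`σ` valuation-preserving, `σϖ = −ϖ`, residually trivial), `M = κ⁻¹(γ−1)κ` of level `ϖ^d`, `d ≥ 2`, and a line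
whose value `(ϖ^d)⁻¹·M₂₀ = (ϖ^d)⁻¹·B₀(x,(γ−1)x)` is residually `s·□` (`∃ a₀, |a₀| = 1 ∧ |(ϖ^d)⁻¹M₂₀ − s·a₀²| < 1`): **the child `Λ′ = latt(κ·g(a,b))` is `CLS (−s)` at depth
`d − 2`** — `∃ y ∈ Λ′, ∃ a′, |a′| = 1 ∧ |(ϖ^{d−2})⁻¹·pairing σ J₀ y ((γ−1)y) − (−s)·a′²| < 1` (witness `y = κ·w(a,b)`, `a′ = a·a₀`; ★ F `v_B₀_mulVec_add_sq_mul_lt`).  The flip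
`s ↦ −s` is the `χ(−1)` of CERT «child-class flip» (B-p14 (g39)). [cite: Kottwitz1986, §3] [cite: Tits1979, §3.5] [cite: BruhatTits1972, §10] -/
theorem exists_mem_childLatt_class_neg_of_lineClass (hvσ : ∀ z, Valued.v (σ z) = Valued.v z) (hσϖ : σ ϖ = -ϖ) (hϖ : Valued.v ϖ = WithZero.exp (-1 : ℤ))
    (hres : ∀ x : K, Valued.v x ≤ 1 → Valued.v (σ x - x) < 1)
    (κ γ : unitaryGroupOfForm σ ((StdForm.antidiagonal 3).over K)) {a b : K} (ha : Valued.v a = 1) (hb : Valued.v b ≤ 1) {d : ℕ} (hd : 2 ≤ d)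
    (hM : ∀ i j, Valued.v (((((κ : GL (Fin 3) K)⁻¹ : GL (Fin 3) K) : Matrix (Fin 3) (Fin 3) K) * (((γ : GL (Fin 3) K) : Matrix (Fin 3) (Fin 3) K) - 1) *
      ((κ : GL (Fin 3) K) : Matrix (Fin 3) (Fin 3) K)) i j) ≤ Valued.v ϖ ^ d)
    {s : K} (hs : ∃ a₀ : K, Valued.v a₀ = 1 ∧ Valued.v ((ϖ ^ d)⁻¹ * ((((κ : GL (Fin 3) K)⁻¹ : GL (Fin 3) K) : Matrix (Fin 3) (Fin 3) K) *
      (((γ : GL (Fin 3) K) : Matrix (Fin 3) (Fin 3) K) - 1) * ((κ : GL (Fin 3) K) : Matrix (Fin 3) (Fin 3) K)) 2 0 - s * a₀ ^ 2) < 1) :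
    ∃ y ∈ latt (((κ : GL (Fin 3) K) : Matrix (Fin 3) (Fin 3) K) * !![a / ϖ, 0, 0; 0, 1, 0; b, 0, ϖ]), ∃ a' : K, Valued.v a' = 1 ∧
      Valued.v ((ϖ ^ (d - 2))⁻¹ * pairing σ ((StdForm.antidiagonal 3).over K) y (((((γ : GL (Fin 3) K)) : Matrix (Fin 3) (Fin 3) K) - 1).mulVec y) - (-s) * a' ^ 2) < 1 := by
  have hϖ0 : ϖ ≠ 0 := fun h0 => by rw [h0, map_zero] at hϖ; exact WithZero.coe_ne_zero hϖ.symm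
  have hvϖ0 : Valued.v ϖ ≠ 0 := (Valuation.ne_zero_iff _).2 hϖ0
  obtain ⟨a₀, ha₀, hs⟩ := hs
  set M : Matrix (Fin 3) (Fin 3) K := (((κ : GL (Fin 3) K)⁻¹ : GL (Fin 3) K) : Matrix (Fin 3) (Fin 3) K) * (((γ : GL (Fin 3) K) : Matrix (Fin 3) (Fin 3) K) - 1) *
      ((κ : GL (Fin 3) K) : Matrix (Fin 3) (Fin 3) K) with hMdef
  -- the witness: `y = κ·w(a,b)`, the first column of the child frame
  refine ⟨((κ : GL (Fin 3) K) : Matrix (Fin 3) (Fin 3) K).mulVec (![a / ϖ, 0, b] : Fin 3 → K), ?_, a * a₀, by rw [map_mul, ha, ha₀, one_mul], ?_⟩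
  · rw [← childFrame_mulVec_single_zero a b, Matrix.mulVec_mulVec]
    exact mulVec_mem_latt _ (single_mem_stdLattice 0)
  -- `B₀(κw, (γ−1)κw) = B₀(w, Mw)`
  have hκu := (mem_unitaryGroupOfForm_antidiagonal_iff (κ : GL (Fin 3) K)).1 κ.2
  rw [pairing_antidiagonal, mulVec_coe_inv_mul_mul, hκu]
  -- ★ F at `u = w(a,b)`: `|B₀(w, Mw) + (a/ϖ)²M₂₀| < |ϖ|^(d-2)`
  have hu0 : Valued.v (ϖ * (![a / ϖ, 0, b] : Fin 3 → K) 0) ≤ 1 := by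
    simp only [Matrix.cons_val_zero]; rw [mul_div_cancel₀ _ hϖ0, ha]
  have hu1 : Valued.v ((![a / ϖ, 0, b] : Fin 3 → K) 1) ≤ 1 := by simp
  have hu2 : Valued.v ((![a / ϖ, 0, b] : Fin 3 → K) 2) ≤ 1 := by simpa using hb
  have hF := v_B₀_mulVec_add_sq_mul_lt hvσ hσϖ hϖ hres hd hM hu0 hu1 hu2
  simp only [Matrix.cons_val_zero] at hF
  -- rescale: `(ϖ^(d-2))⁻¹·(B₀ + (a/ϖ)²M₂₀) − a²·((ϖ^d)⁻¹M₂₀ − s a₀²) = (ϖ^(d-2))⁻¹B₀ + s(a a₀)²`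
  have hpow : ϖ ^ d = ϖ ^ (d - 2) * ϖ ^ 2 := by rw [← pow_add]; congr 1; omega
  have e : (ϖ ^ (d - 2))⁻¹ * B₀ σ 3 (![a / ϖ, 0, b] : Fin 3 → K) (M.mulVec ![a / ϖ, 0, b]) - (-s) * (a * a₀) ^ 2 =
      (ϖ ^ (d - 2))⁻¹ * (B₀ σ 3 (![a / ϖ, 0, b] : Fin 3 → K) (M.mulVec ![a / ϖ, 0, b]) + (a / ϖ) ^ 2 * M 2 0) - a ^ 2 * ((ϖ ^ d)⁻¹ * M 2 0 - s * a₀ ^ 2) := by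
    rw [hpow]; field_simp; ring
  rw [e]
  refine Valuation.map_sub_lt _ ?_ ?_
  · rw [map_mul, map_inv₀, map_pow]
    have hne : (Valued.v ϖ ^ (d - 2))⁻¹ ≠ 0 := inv_ne_zero (pow_ne_zero _ hvϖ0)
    calc (Valued.v ϖ ^ (d - 2))⁻¹ * Valued.v (B₀ σ 3 (![a / ϖ, 0, b] : Fin 3 → K) (M.mulVec ![a / ϖ, 0, b]) + (a / ϖ) ^ 2 * M 2 0)
        < (Valued.v ϖ ^ (d - 2))⁻¹ * Valued.v ϖ ^ (d - 2) := mul_lt_mul_of_pos_left hF (zero_lt_iff.2 hne)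
      _ = 1 := inv_mul_cancel₀ (pow_ne_zero _ hvϖ0)
  · rw [map_mul, map_pow, ha, one_pow, one_mul]; exact hs

end Literature.NumberTheory.Automorphic.UnitaryLatticeTree

end
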